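import Summits.ResolutionOfSingularities.ResolutionOfSingularities.Theorems.EquisingularLiftEquisingularLiftNatVertexLineDefs
import Summits.ResolutionOfSingularities.ResolutionOfSingularities.Theorems.EquisingularLiftEquisingularLiftNatProjLinearAut
import Summits.ResolutionOfSingularities.ResolutionOfSingularities.Theorems.EquisingularLiftEquisingularLiftNatPointStepTransport
import HarnessLib

/-!
# [OURS · L1 W4.5(b) · EL♮(3) · nose residue, (c) file 4a] STEINER'S THREE LINES IN ONE CHART, I: the linear automorphism
# `x₀ ↦ x₀ − x₁ − x₂` of `ℙ³`, the blowing up `b′ = b ≫ ψ⁻¹` of the vertex, and the three lines as `V₊(x₁ − q₁x₀, x₂ − q₂x₀)`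

Crux chain w45b, child EL♮(3) = stmt-ResolutionOfSingularities-20148; WIDTH seat res-L1-w45b-nose-w3 g3 (D-0157 DOOR 1), brick (c) = the
×3 UNION certificate `DirStepUnobs F₂ univ (⋃ i, vertexLineStrict υ i)` of res-L1-w45b-nose-w2's «Steiner ∈ ν2» assembly (027's (U1) recipe of
record, STATUS 2026-08-28T19:33Z). `--supports stmt-ResolutionOfSingularities-20148 --as helper`. OURS; NOT a statement of any manuscript; AI-written,
weaker than expert review. No `sorry`; standard axioms; DEF-FREE (the automorphism is delivered by an `∃`; the kit's local-instance attribute is needed to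
write `Proj k[x]`). Resolution in char `p` NOT proved here (dim 3: Cossart–Piltant 2008/2009 in print).

WHAT (`ℙ³ = Proj k[x₀,…,x₃]`, vertex `p = (0:0:0:1)`, `b : P̃ ⟶ ℙ³` ANY blowing up of `p`):
* ★ `ThreeLines.exists_linearAut` — a scheme automorphism `ψ` of `ℙ³` FIXING THE VERTEX with `x₀ ∈ ψ(y) ↔ x₀ − x₁ − x₂ ∈ y`, `x₁ ∈ ψ(y) ↔ x₁ ∈ y`,
  `x₂ ∈ ψ(y) ↔ x₂ ∈ y` (res-L1-w45b-iso-w4 ✓ `ProjLin.exists_iso_comap` with the unimodular matrix `N = [[1,−1,−1,0],[0,1,0,0],[0,0,1,0],[0,0,0,1]]`).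
* `inv_apply_vertex`, `isBlowup_comp_inv` — `b′ = b ≫ ψ⁻¹` is again a blowing up of the vertex (✓ `isBlowup_comp_iso_vanishingIdeal_singleton`);
  `preimage_eq_preimage_comp`; ★ `vertexLineStrict_eq_closure_preimage` — **the three Steiner lines `vertexLineStrict b i` (`i = 0, 1, 2`) are the
  strict transforms under `b′` of the lines `V₊(x₁ − q₁x₀, x₂ − q₂x₀)` through `p` with `q = (0,0), (1,0), (0,1)`** — three points of ONE chart.

References (index only): R. Hartshorne (1977), II §7, II Ex. 2.14 [cite: Hartshorne1977]; J. Harris (1992), Lecture 1 [cite: Harris1992];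
A. J. de Jong (1996), proof of Lemma 4.11 [cite: DeJong1996].
-/

set_option linter.dupNamespace false -- mandated namespace `Summit.<Summit>.<Problem>` of this single-conjunct summit

noncomputable section

-- `Proj`/`ProjectiveSpectrum` carrier coercions under `instances` transparency (as in the chain's other chart files).
set_option backward.isDefEq.respectTransparency false

open CategoryTheory AlgebraicGeometry TopologicalSpace HomogeneousLocalization Topology MvPolynomial
open Literature.AlgebraicGeometry.Resolution Literature.AlgebraicGeometry.Resolution.DeJong1996
open Literature.AlgebraicGeometry.Resolution.PointBlowup (Chart Base frac exc polyEquiv polyHom baseHom)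
open Literature.AlgebraicGeometry.Motives.Segre (grading X_mem chartι)
open AlgebraicGeometry.Scheme.IdealSheafData

attribute [local instance] MvPolynomial.gradedAlgebra Literature.AlgebraicGeometry.Motives.ProjBaseChange.algebraBase
  Literature.AlgebraicGeometry.Motives.ProjBaseChange.isScalarTower_localization

namespace Summit.ResolutionOfSingularities.ResolutionOfSingularities.Cruxes.EquisingularLiftNat.Sections

namespace ThreeLines

variable {k : Type} [Field k]

/-! ## The linear automorphism `x₀ ↦ x₀ − x₁ − x₂` of `ℙ³` -/

/-- ★ **A scheme automorphism of `ℙ³_k` fixing the vertex `(0:0:0:1)` under which `x₀ ↦ x₀ − x₁ − x₂` on homogeneous primes** (and `x₁, x₂` are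
kept): res-L1-w45b-iso-w4's ✓ `ProjLin.exists_iso_comap` for the unimodular matrix `N = [[1,−1,−1,0],[0,1,0,0],[0,0,1,0],[0,0,0,1]]`.
[cite: Hartshorne1977, II Ex. 2.14] (OURS instance) -/
theorem exists_linearAut :
    ∃ ψ : Proj (grading (Fin (2 + 1 + 1)) k) ≅ Proj (grading (Fin (2 + 1 + 1)) k),
      ψ.hom (vertex 2 k) = vertex 2 k ∧
      ∀ y : Proj (grading (Fin (2 + 1 + 1)) k),
        ((X 0 : MvPolynomial (Fin (2 + 1 + 1)) k) ∈ (ψ.hom y).asHomogeneousIdeal ↔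
            (X 0 - X 1 - X 2 : MvPolynomial (Fin (2 + 1 + 1)) k) ∈ y.asHomogeneousIdeal) ∧
        ((X 1 : MvPolynomial (Fin (2 + 1 + 1)) k) ∈ (ψ.hom y).asHomogeneousIdeal ↔
            (X 1 : MvPolynomial (Fin (2 + 1 + 1)) k) ∈ y.asHomogeneousIdeal) ∧
        ((X 2 : MvPolynomial (Fin (2 + 1 + 1)) k) ∈ (ψ.hom y).asHomogeneousIdeal ↔
            (X 2 : MvPolynomial (Fin (2 + 1 + 1)) k) ∈ y.asHomogeneousIdeal) := by
  let N : Matrix (Fin (2 + 1 + 1)) (Fin (2 + 1 + 1)) k := !![1, -1, -1, 0; 0, 1, 0, 0; 0, 0, 1, 0; 0, 0, 0, 1]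
  let N' : Matrix (Fin (2 + 1 + 1)) (Fin (2 + 1 + 1)) k := !![1, 1, 1, 0; 0, 1, 0, 0; 0, 0, 1, 0; 0, 0, 0, 1]
  have hNN' : N * N' = 1 := by
    ext i j
    fin_cases i <;> fin_cases j <;> simp [N, N', Matrix.mul_apply, Fin.sum_univ_four]
  have hN : IsUnit N.det := Matrix.isUnit_det_of_right_inverse hNN'
  have hN0 : aeval N.toMvPolynomial (X 0 : MvPolynomial (Fin (2 + 1 + 1)) k) = X 0 - X 1 - X 2 := by
    rw [aeval_X, Matrix.toMvPolynomial, Fin.sum_univ_four]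
    simp only [N, Matrix.of_apply, Matrix.cons_val', Matrix.cons_val_zero, Matrix.cons_val_one, Matrix.cons_val_fin_one,
      Matrix.cons_val, ← C_mul_X_eq_monomial, map_one, map_neg, map_zero, one_mul, add_zero]
    ring
  have hN1 : aeval N.toMvPolynomial (X 1 : MvPolynomial (Fin (2 + 1 + 1)) k) = X 1 := by
    rw [aeval_X, Matrix.toMvPolynomial, Fin.sum_univ_four]
    simp only [N, Matrix.of_apply, Matrix.cons_val', Matrix.cons_val_zero, Matrix.cons_val_one, Matrix.cons_val_fin_one,
      Matrix.cons_val, ← C_mul_X_eq_monomial, map_one, map_zero, one_mul, add_zero, zero_add]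
  have hN2 : aeval N.toMvPolynomial (X 2 : MvPolynomial (Fin (2 + 1 + 1)) k) = X 2 := by
    rw [aeval_X, Matrix.toMvPolynomial, Fin.sum_univ_four]
    simp only [N, Matrix.of_apply, Matrix.cons_val', Matrix.cons_val_zero, Matrix.cons_val_one, Matrix.cons_val_fin_one,
      Matrix.cons_val, ← C_mul_X_eq_monomial, map_one, map_zero, one_mul, add_zero, zero_add]
  obtain ⟨ψ, hψ⟩ := ProjLin.exists_iso_comap (n := 2 + 1) hN
  refine ⟨ψ, ?_, fun y => ⟨?_, ?_, ?_⟩⟩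
  · rw [eq_vertex_iff]
    intro i
    rw [hψ]
    fin_cases i
    · change aeval N.toMvPolynomial (X 0 : MvPolynomial (Fin (2 + 1 + 1)) k) ∈ _
      rw [hN0]
      exact Ideal.sub_mem _ (Ideal.sub_mem _ (X_castSucc_mem_vertexIdeal 2 k 0) (X_castSucc_mem_vertexIdeal 2 k 1))
        (X_castSucc_mem_vertexIdeal 2 k 2)
    · change aeval N.toMvPolynomial (X 1 : MvPolynomial (Fin (2 + 1 + 1)) k) ∈ _
      rw [hN1]; exact X_castSucc_mem_vertexIdeal 2 k 1
    · change aeval N.toMvPolynomial (X 2 : MvPolynomial (Fin (2 + 1 + 1)) k) ∈ _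
      rw [hN2]; exact X_castSucc_mem_vertexIdeal 2 k 2
  · rw [hψ, hN0]
  · rw [hψ, hN1]
  · rw [hψ, hN2]

/-! ## The blowing up `b′ = b ≫ ψ⁻¹` and the three lines -/

section Lines

variable (ψ : Proj (grading (Fin (2 + 1 + 1)) k) ≅ Proj (grading (Fin (2 + 1 + 1)) k)) (hψv : ψ.hom (vertex 2 k) = vertex 2 k)
  (hψ : ∀ y : Proj (grading (Fin (2 + 1 + 1)) k),
    ((X 0 : MvPolynomial (Fin (2 + 1 + 1)) k) ∈ (ψ.hom y).asHomogeneousIdeal ↔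
        (X 0 - X 1 - X 2 : MvPolynomial (Fin (2 + 1 + 1)) k) ∈ y.asHomogeneousIdeal) ∧
    ((X 1 : MvPolynomial (Fin (2 + 1 + 1)) k) ∈ (ψ.hom y).asHomogeneousIdeal ↔
        (X 1 : MvPolynomial (Fin (2 + 1 + 1)) k) ∈ y.asHomogeneousIdeal) ∧
    ((X 2 : MvPolynomial (Fin (2 + 1 + 1)) k) ∈ (ψ.hom y).asHomogeneousIdeal ↔
        (X 2 : MvPolynomial (Fin (2 + 1 + 1)) k) ∈ y.asHomogeneousIdeal))
  {P : Scheme.{0}} (b : P ⟶ Proj (grading (Fin (2 + 1 + 1)) k)) (hb : IsBlowup b (vertexIdealSheaf 2 k))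

include hψv in
/-- `ψ⁻¹` fixes the vertex too. [folklore] -/
theorem inv_apply_vertex : ψ.inv (vertex 2 k) = vertex 2 k := by
  conv_lhs => rw [← hψv]
  rw [← Scheme.Hom.comp_apply ψ.hom ψ.inv, ψ.hom_inv_id]
  rfl

include hψv hb in
/-- **`b′ = b ≫ ψ⁻¹` is again a blowing up of the vertex.** [folklore] (✓ `isBlowup_comp_iso_vanishingIdeal_singleton`) -/
theorem isBlowup_comp_inv : IsBlowup (b ≫ ψ.inv) (vertexIdealSheaf 2 k) := by
  have hcl : IsClosed ({ψ.symm.hom (vertex 2 k)} : Set (Proj (grading (Fin (2 + 1 + 1)) k))) := by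
    rw [Iso.symm_hom, inv_apply_vertex ψ hψv]; exact isClosed_singleton_vertex 2 k
  have h := isBlowup_comp_iso_vanishingIdeal_singleton (isClosed_singleton_vertex 2 k) hb ψ.symm hcl
  have e : (⟨{ψ.symm.hom (vertex 2 k)}, hcl⟩ : Closeds (Proj (grading (Fin (2 + 1 + 1)) k))) =
      ⟨{vertex 2 k}, isClosed_singleton_vertex 2 k⟩ := Closeds.ext (by rw [Closeds.coe_mk, Closeds.coe_mk, Iso.symm_hom, inv_apply_vertex ψ hψv])
  rw [e] at h
  exact h

/-- Preimages under `b` are preimages under `b ≫ ψ⁻¹` of preimages under `ψ`. [folklore] -/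
theorem preimage_eq_preimage_comp (S : Set (Proj (grading (Fin (2 + 1 + 1)) k))) :
    b ⁻¹' S = (b ≫ ψ.inv) ⁻¹' ((ψ.hom : Proj (grading (Fin (2 + 1 + 1)) k) → _) ⁻¹' S) := by
  ext x
  simp only [Set.mem_preimage]
  rw [Scheme.Hom.comp_apply b ψ.inv, ← Scheme.Hom.comp_apply ψ.inv ψ.hom, ψ.inv_hom_id]
  rfl

include hψv hψ in
/-- ★ **The three Steiner lines in one chart**: for `q ∈ {(0,0), (1,0), (0,1)}` and `i` the corresponding index (`0, 1, 2`),
`vertexLineStrict b i = closure ((b ≫ ψ⁻¹)⁻¹ (V₊(x₁ − q₁x₀, x₂ − q₂x₀) ∖ {p}))`. [cite: Hartshorne1977, II §7] (OURS computation) -/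
theorem vertexLineStrict_eq_closure_preimage (i : Fin (2 + 1)) :
    vertexLineStrict b i =
      closure ((b ≫ ψ.inv) ⁻¹' ({y : Proj (grading (Fin (2 + 1 + 1)) k) |
        (X 1 - C ((![![0, 0], ![1, 0], ![0, 1]] : Fin (2 + 1) → Fin 2 → k) i 0) * X 0 : MvPolynomial (Fin (2 + 1 + 1)) k) ∈
            y.asHomogeneousIdeal ∧
        (X 2 - C ((![![0, 0], ![1, 0], ![0, 1]] : Fin (2 + 1) → Fin 2 → k) i 1) * X 0 : MvPolynomial (Fin (2 + 1 + 1)) k) ∈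
            y.asHomogeneousIdeal} \ {vertex 2 k})) := by
  rw [vertexLineStrict, preimage_eq_preimage_comp ψ b]
  congr 2
  ext y
  simp only [Set.mem_preimage, Set.mem_sdiff, Set.mem_singleton_iff, Set.mem_setOf_eq, mem_vertexLine_iff]
  have hinj : ψ.hom y = vertex 2 k ↔ y = vertex 2 k := by
    constructor
    · intro h
      have h2 : ψ.inv (ψ.hom y) = ψ.inv (vertex 2 k) := by rw [h]
      rwa [← Scheme.Hom.comp_apply ψ.hom ψ.inv, ψ.hom_inv_id, inv_apply_vertex ψ hψv] at h2
    · rintro rfl; exact hψv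
  rw [hinj]
  obtain ⟨h0, h1, h2⟩ := hψ y
  refine and_congr_left fun _ => ?_
  fin_cases i
  · -- `i = 0`: `x₁, x₂ ∈ ψ y ↔ x₁, x₂ ∈ y`
    change (∀ j : Fin (2 + 1), j ≠ 0 → (X (Fin.castSucc j) : MvPolynomial (Fin (2 + 1 + 1)) k) ∈ (ψ.hom y).asHomogeneousIdeal) ↔
      (X 1 - C (0 : k) * X 0 : MvPolynomial (Fin (2 + 1 + 1)) k) ∈ y.asHomogeneousIdeal ∧
        (X 2 - C (0 : k) * X 0 : MvPolynomial (Fin (2 + 1 + 1)) k) ∈ y.asHomogeneousIdeal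
    simp only [map_zero, zero_mul, sub_zero]
    constructor
    · intro h
      exact ⟨h1.mp (h 1 (by decide)), h2.mp (h 2 (by decide))⟩
    · rintro ⟨hy1, hy2⟩ j hj
      fin_cases j
      · exact absurd rfl hj
      · exact h1.mpr hy1
      · exact h2.mpr hy2
  · -- `i = 1`: `x₀, x₂ ∈ ψ y ↔ x₁ − x₀, x₂ ∈ y`
    change (∀ j : Fin (2 + 1), j ≠ 1 → (X (Fin.castSucc j) : MvPolynomial (Fin (2 + 1 + 1)) k) ∈ (ψ.hom y).asHomogeneousIdeal) ↔
      (X 1 - C (1 : k) * X 0 : MvPolynomial (Fin (2 + 1 + 1)) k) ∈ y.asHomogeneousIdeal ∧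
        (X 2 - C (0 : k) * X 0 : MvPolynomial (Fin (2 + 1 + 1)) k) ∈ y.asHomogeneousIdeal
    simp only [map_zero, zero_mul, sub_zero, map_one, one_mul]
    constructor
    · intro h
      have hx0 := h0.mp (h 0 (by decide))
      have hx2 := h2.mp (h 2 (by decide))
      refine ⟨?_, hx2⟩
      have : (X 1 - X 0 : MvPolynomial (Fin (2 + 1 + 1)) k) = -(X 0 - X 1 - X 2) - X 2 := by ring
      rw [this]
      exact Ideal.sub_mem _ (Submodule.neg_mem _ hx0) hx2
    · rintro ⟨hy1, hy2⟩ j hj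
      fin_cases j
      · refine h0.mpr ?_
        have : (X 0 - X 1 - X 2 : MvPolynomial (Fin (2 + 1 + 1)) k) = -(X 1 - X 0) - X 2 := by ring
        rw [this]
        exact Ideal.sub_mem _ (Submodule.neg_mem _ hy1) hy2
      · exact absurd rfl hj
      · exact h2.mpr hy2
  · -- `i = 2`: `x₀, x₁ ∈ ψ y ↔ x₁, x₂ − x₀ ∈ y`
    change (∀ j : Fin (2 + 1), j ≠ 2 → (X (Fin.castSucc j) : MvPolynomial (Fin (2 + 1 + 1)) k) ∈ (ψ.hom y).asHomogeneousIdeal) ↔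
      (X 1 - C (0 : k) * X 0 : MvPolynomial (Fin (2 + 1 + 1)) k) ∈ y.asHomogeneousIdeal ∧
        (X 2 - C (1 : k) * X 0 : MvPolynomial (Fin (2 + 1 + 1)) k) ∈ y.asHomogeneousIdeal
    simp only [map_zero, zero_mul, sub_zero, map_one, one_mul]
    constructor
    · intro h
      have hx0 := h0.mp (h 0 (by decide))
      have hx1 := h1.mp (h 1 (by decide))
      refine ⟨hx1, ?_⟩
      have : (X 2 - X 0 : MvPolynomial (Fin (2 + 1 + 1)) k) = -(X 0 - X 1 - X 2) - X 1 := by ring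
      rw [this]
      exact Ideal.sub_mem _ (Submodule.neg_mem _ hx0) hx1
    · rintro ⟨hy1, hy2⟩ j hj
      fin_cases j
      · refine h0.mpr ?_
        have : (X 0 - X 1 - X 2 : MvPolynomial (Fin (2 + 1 + 1)) k) = -(X 2 - X 0) - X 1 := by ring
        rw [this]
        exact Ideal.sub_mem _ (Submodule.neg_mem _ hy2) hy1
      · exact h1.mpr hy1
      · exact absurd rfl hj

end Lines
end ThreeLines

end Summit.ResolutionOfSingularities.ResolutionOfSingularities.Cruxes.EquisingularLiftNat.Sections

end
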